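import Mathlib.NumberTheory.LSeries.PrimesInAP
import Mathlib.NumberTheory.LegendreSymbol.JacobiSymbol
import Mathlib.Algebra.Squarefree.Basic
import HarnessLib

/-!
# Route `RamifiedHeegnerPair`, support item `RamifiedTwistSupply` (stmt-BirchSwinnertonDyer-23194):
# stub `stub_auxDiscriminant` of the line `supply-imaginary-pair` — the auxiliary imaginary discriminant

The checked skeleton `Cruxes/RamifiedPairLowerBound/SupplyViaImaginaryPair.lean` (planner
bsd-trib-w-rhp g3, commit abe3e481245d) reduces the support item `RamifiedTwistSupply` to five stubs.
This file proves the second one VERBATIM: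

`stub_auxDiscriminant (N₀ : ℕ) (hN₀ : N₀ ≠ 0) (h3 : ¬ 3 ∣ N₀) :
  ∃ D₁ : ℤ, D₁ < 0 ∧ D₁ % 4 = 1 ∧ Squarefree D₁ ∧ Int.gcd D₁ N₀ = 1 ∧ ¬ (3 : ℤ) ∣ D₁ ∧ J(N₀ | |D₁|) = J(N₀ | 3)`.

Proof (no reciprocity casework): take `D₁ = −q` with `q` a prime, `q > N₀ + 3`, `q ≡ 3 (mod 4N₀)`
(Dirichlet, Mathlib `Nat.forall_exists_prime_gt_and_zmodEq`; `gcd(3, 4N₀) = 1` because `3 ∤ N₀`). Then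
`D₁ ≡ −3 ≡ 1 (mod 4)`, `D₁` is squarefree and prime to `3N₀` (`q > N₀ + 3` is a prime), and the Jacobi
symbol `J(N₀ | b)` for odd `b` depends only on `b mod 4N₀` (Mathlib `jacobiSym.mod_right`), so
`J(N₀ | q) = J(N₀ | 3)`.

Prover bsd-wall-utd-p3 g8 (cross-route utility inside W-ALL row 2·3@3), 2026-08-28. Pure elementary number
theory; BSD is not proved by any of this.
-/

open scoped NumberTheorySymbols

set_option linter.dupNamespace false

namespace Summit.BirchSwinnertonDyer.BirchSwinnertonDyer.Theorems.RamifiedTwistSupplyStubs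

/-- **Auxiliary imaginary prime discriminant with prescribed Jacobi symbol.** For `N₀ ≠ 0` with `3 ∤ N₀`
there is a prime `q > N₀ + 3` with `q ≡ 3 (mod 4N₀)`; for any such `q`, `J(N₀ | q) = J(N₀ | 3)`
(the symbol depends on the odd lower entry only modulo `4N₀`). -/
theorem exists_prime_gt_modEq_three_jacobiSym_eq (N₀ : ℕ) (hN₀ : N₀ ≠ 0) (h3 : ¬ 3 ∣ N₀) :
    ∃ q : ℕ, q.Prime ∧ N₀ + 3 < q ∧ (q : ℤ) ≡ 3 [ZMOD (4 * N₀ : ℕ)] ∧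
      J((N₀ : ℤ) | q) = J((N₀ : ℤ) | 3) := by
  have hcop : IsCoprime (3 : ℤ) ((4 * N₀ : ℕ) : ℤ) := by
    have h : Nat.Coprime 3 (4 * N₀) :=
      Nat.Coprime.mul_right (by decide) ((Nat.Prime.coprime_iff_not_dvd Nat.prime_three).mpr h3)
    exact_mod_cast Nat.Coprime.isCoprime h
  have hq0 : (4 * N₀ : ℕ) ≠ 0 := mul_ne_zero (by decide) hN₀
  obtain ⟨q, hqgt, hqp, hqmod⟩ :=
    Nat.forall_exists_prime_gt_and_zmodEq (N₀ + 3) hq0 (a := (3 : ℤ)) hcop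
  refine ⟨q, hqp, hqgt, hqmod, ?_⟩
  -- `q % (4 N₀) = 3 % (4 N₀)` as natural numbers
  have hnat : q ≡ 3 [MOD (4 * N₀)] := by
    have : (q : ℤ) ≡ ((3 : ℕ) : ℤ) [ZMOD ((4 * N₀ : ℕ) : ℤ)] := by exact_mod_cast hqmod
    exact Int.natCast_modEq_iff.mp this
  have hqodd : Odd q := hqp.odd_of_ne_two (by omega)
  rw [jacobiSym.mod_right (N₀ : ℤ) hqodd, jacobiSym.mod_right (N₀ : ℤ) (b := 3) (by decide)]
  simp only [Int.natAbs_natCast]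
  rw [hnat]

/-- **Stub `stub_auxDiscriminant` of `Cruxes/RamifiedPairLowerBound/SupplyViaImaginaryPair.lean`, verbatim
signature (Dirichlet + the `4N₀`-periodicity of the Jacobi symbol).** For `N₀ ≠ 0` with `3 ∤ N₀` there is
a squarefree `D₁ < 0`, `D₁ ≡ 1 (mod 4)`, prime to `3 N₀`, with `(N₀ / |D₁|) = (N₀ / 3)` (Jacobi symbols):
`D₁ = −q` for a prime `q ≡ 3 (mod 4N₀)`, `q > N₀ + 3`. -/
theorem auxDiscriminant (N₀ : ℕ) (hN₀ : N₀ ≠ 0) (h3 : ¬ 3 ∣ N₀) :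
    ∃ D₁ : ℤ, D₁ < 0 ∧ D₁ % 4 = 1 ∧ Squarefree D₁ ∧ Int.gcd D₁ N₀ = 1 ∧ ¬ (3 : ℤ) ∣ D₁ ∧
      J(N₀ | D₁.natAbs) = J(N₀ | 3) := by
  obtain ⟨q, hqp, hqgt, hqmod, hJ⟩ := exists_prime_gt_modEq_three_jacobiSym_eq N₀ hN₀ h3
  refine ⟨-(q : ℤ), ?_, ?_, ?_, ?_, ?_, ?_⟩
  · -- `D₁ < 0`
    have : (0 : ℤ) < q := by exact_mod_cast hqp.pos
    omega
  · -- `D₁ ≡ 1 (mod 4)`: `q ≡ 3 (mod 4)`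
    have h4 : (q : ℤ) ≡ 3 [ZMOD 4] := by
      have hmul : ((4 * N₀ : ℕ) : ℤ) = 4 * (N₀ : ℤ) := by push_cast; ring
      rw [hmul] at hqmod
      exact Int.ModEq.of_mul_right _ hqmod
    have hneg : (-(q : ℤ)) ≡ 1 [ZMOD 4] := h4.neg.trans (by decide)
    have h1 : (-(q : ℤ)) % 4 = 1 % 4 := hneg
    omega
  · -- squarefree
    rw [← Int.squarefree_natAbs, Int.natAbs_neg, Int.natAbs_natCast]
    exact hqp.prime.squarefree
  · -- prime to `N₀`: `q > N₀` is a prime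
    rw [Int.gcd_eq_natAbs, Int.natAbs_neg, Int.natAbs_natCast, Int.natAbs_natCast]
    exact (Nat.Prime.coprime_iff_not_dvd hqp).mpr
      (fun hdvd => absurd (Nat.le_of_dvd (Nat.pos_of_ne_zero hN₀) hdvd) (by omega))
  · -- `3 ∤ D₁`
    intro hdvd
    have h' : (3 : ℤ) ∣ (q : ℤ) := (Int.dvd_neg).mp hdvd
    have h'' : 3 ∣ q := by exact_mod_cast h'
    have := (Nat.prime_dvd_prime_iff_eq Nat.prime_three hqp).mp h''
    omega
  · -- the Jacobi symbol
    rw [Int.natAbs_neg, Int.natAbs_natCast]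
    exact hJ

end Summit.BirchSwinnertonDyer.BirchSwinnertonDyer.Theorems.RamifiedTwistSupplyStubs
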